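import Literature.Analysis.FluidPDE.ParabolicRescale
import Literature.Analysis.FluidPDE.SpaceTimeRescaling
import Literature.Analysis.FluidPDE.CarlemanCalculus
import HarnessLib

/-!
# Parabolic rescaling in the frame operators, and the initial layer (Seregin 2014, App. A.2–A.3)

Analysis/FluidPDE support file (theorems only) in the backward-uniqueness track of **ns.S08**
(`ess_backward_uniqueness`, ESS 2003 Thm. 5.1 = Seregin 2014, Thm. A.3.5). Seregin's proofs of
Lemmas A.1–A.4 pass to rescaled functions `v(y, s) = u(x₀ + λ y, t₀ + λ² s)` ("usual parabolic
scaling"); this file provides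

* the **chain rules** for uncurried fields `U ∘ Φ`, `Φ(s, y) = (t₀ + β s, x₀ + γ y)` the accepted
  space–time affine map `stAffine β γ t₀ x₀` (`SpaceTimeRescaling.lean`), in the frame operators
  of `CarlemanCalculus.lean`: `∂ₛ(U ∘ Φ) = β ∂ₜU ∘ Φ`, `∂ₑ(U ∘ Φ) = γ ∂ₑU ∘ Φ`,
  `Δ(U ∘ Φ) = γ² ΔU ∘ Φ`, `|∇(U ∘ Φ)|² = γ² |∇U|² ∘ Φ` (all unconditional: both sides carry the
  same junk values), smoothness transfer, and the transfer of the backward heat inequality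
  `|∂ₜU + ΔU| ≤ c(|U| + |∇U|)` with constant `c γ` when `β = γ²`, `0 < γ ≤ 1`
  (Seregin 2014, (A.2.5), (A.3.8), (A.3.17));
* the **initial layer estimate** replacing Seregin's extension of `u` by zero to negative times
  (which is not available for `C²` data): if `V` is `C¹` on an open set containing
  `]s₀, s₀ + S[ × B`, continuous on `[s₀, s₀ + S[ × B` with `V(s₀, ·) = 0` on `B`, then
  `∫_{]s₀, s₀+T[ × B} ‖V‖² ≤ T² ∫_{]s₀, s₀+T[ × B} ‖∂ₛV‖²` (fundamental theorem of calculus in `s`,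
  Cauchy–Schwarz, Tonelli), whence `θ⁻² ∫_{]s₀, s₀+θ[ × B} ‖V‖² → 0` as `θ → 0` as soon as
  `∂ₛV` is square integrable near the initial slice (the hypothesis (A.3.4) of the theorem) —
  this is what controls the error produced by a time cut-off of width `θ` at the initial slice.

All statements are proved; no definitions.

## References

* G. Seregin, *Lecture notes on regularity theory for the Navier–Stokes equations*, World
  Scientific 2014, App. A.2 (A.2.5), App. A.3 (A.3.7)–(A.3.10), (A.3.17)–(A.3.18). [Seregin2014]
-/

noncomputable section

open MeasureTheory Set Function Filter Metric
open _root_.Topology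
open scoped InnerProductSpace RealInnerProductSpace ENNReal

namespace Literature.Analysis.FluidPDE

namespace Carleman

/-! ### Chain rules under the space–time affine maps -/

section ChainRules

variable {E : Type*} [NormedAddCommGroup E] [InnerProductSpace ℝ E]
variable {F : Type*} [NormedAddCommGroup F] [NormedSpace ℝ F]
variable {β γ t₀ : ℝ} {x₀ : E}

omit [NormedAddCommGroup F] [NormedSpace ℝ F] in
/-- `U ∘ Φ` as the composition of a translate of `U` with the linear scale change
`(s, y) ↦ (β s, γ y)`. [folklore] -/
theorem comp_stAffine_eq (hβ : β ≠ 0) (hγ : γ ≠ 0) (U : ℝ × E → F) :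
    (fun z => U (stAffine β γ t₀ x₀ z)) =
      (fun w => U (((t₀, x₀) : ℝ × E) + w)) ∘ (scaleCLE (E := E) hβ hγ) := by
  funext z
  simp only [comp_apply, scaleCLE_apply, stAffine, Prod.mk_add_mk]

/-- **Chain rule** for `U ∘ Φ` (unconditional): `D(U ∘ Φ)(z) v = DU(Φ z) (β v₁, γ v₂)`. [folklore] -/
theorem fderiv_comp_stAffine_apply (hβ : β ≠ 0) (hγ : γ ≠ 0) (U : ℝ × E → F) (z v : ℝ × E) :
    fderiv ℝ (fun z => U (stAffine β γ t₀ x₀ z)) z v =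
      fderiv ℝ U (stAffine β γ t₀ x₀ z) (β * v.1, γ • v.2) := by
  rw [comp_stAffine_eq hβ hγ, (scaleCLE (E := E) hβ hγ).comp_right_fderiv,
    ContinuousLinearMap.comp_apply, fderiv_comp_add_left]
  simp only [ContinuousLinearEquiv.coe_coe, scaleCLE_apply, stAffine, Prod.mk_add_mk]

/-- `∂ₛ(U ∘ Φ) = β ∂ₜU ∘ Φ`. [folklore] -/
theorem dt_comp_stAffine (hβ : β ≠ 0) (hγ : γ ≠ 0) (U : ℝ × E → F) (z : ℝ × E) :
    dt (fun z => U (stAffine β γ t₀ x₀ z)) z = β • dt U (stAffine β γ t₀ x₀ z) := by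
  rw [dt_apply, dt_apply, fderiv_comp_stAffine_apply hβ hγ]
  simp only [mul_one, smul_zero]
  rw [show ((β, 0) : ℝ × E) = β • ((1, 0) : ℝ × E) by simp, map_smul]

/-- `∂ₑ(U ∘ Φ) = γ ∂ₑU ∘ Φ`. [folklore] -/
theorem dx_comp_stAffine (hβ : β ≠ 0) (hγ : γ ≠ 0) (U : ℝ × E → F) (e : E) (z : ℝ × E) :
    dx e (fun z => U (stAffine β γ t₀ x₀ z)) z = γ • dx e U (stAffine β γ t₀ x₀ z) := by
  rw [dx_apply, dx_apply, fderiv_comp_stAffine_apply hβ hγ]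
  simp only [mul_zero]
  rw [show ((0, γ • e) : ℝ × E) = γ • ((0, e) : ℝ × E) by simp, map_smul]

/-- `∂ₑ∂ₑ'(U ∘ Φ) = γ² ∂ₑ∂ₑ'U ∘ Φ`. [folklore] -/
theorem dx_dx_comp_stAffine (hβ : β ≠ 0) (hγ : γ ≠ 0) (U : ℝ × E → F) (e e' : E) (z : ℝ × E) :
    dx e (dx e' fun z => U (stAffine β γ t₀ x₀ z)) z =
      γ ^ 2 • dx e (dx e' U) (stAffine β γ t₀ x₀ z) := by
  have h1 : dx e' (fun z => U (stAffine β γ t₀ x₀ z)) =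
      γ • fun z => dx e' U (stAffine β γ t₀ x₀ z) := by
    funext w; simp only [Pi.smul_apply]; exact dx_comp_stAffine hβ hγ U e' w
  rw [h1, dx_apply, fderiv_const_smul_field, Pi.smul_apply, FunLike.coe_smul,
    Pi.smul_apply, ← dx_apply, dx_comp_stAffine hβ hγ (dx e' U) e z, smul_smul, sq]

variable [FiniteDimensional ℝ E]

/-- `Δ(U ∘ Φ) = γ² ΔU ∘ Φ`. [folklore] -/
theorem lap_comp_stAffine (hβ : β ≠ 0) (hγ : γ ≠ 0) (U : ℝ × E → F) (z : ℝ × E) :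
    lap (fun z => U (stAffine β γ t₀ x₀ z)) z = γ ^ 2 • lap U (stAffine β γ t₀ x₀ z) := by
  simp only [lap, dx_dx_comp_stAffine hβ hγ, Finset.smul_sum]

/-- `|∇(U ∘ Φ)|² = γ² |∇U|² ∘ Φ`. [folklore] -/
theorem gradSq_comp_stAffine (hβ : β ≠ 0) (hγ : γ ≠ 0) (U : ℝ × E → F) (z : ℝ × E) :
    gradSq (fun z => U (stAffine β γ t₀ x₀ z)) z = γ ^ 2 * gradSq U (stAffine β γ t₀ x₀ z) := by
  simp only [gradSq, dx_comp_stAffine hβ hγ, norm_smul, Real.norm_eq_abs, mul_pow, sq_abs,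
    Finset.mul_sum]

omit [FiniteDimensional ℝ E] in
/-- Smoothness transfer: `U ∈ Cⁿ(O)` implies `U ∘ Φ ∈ Cⁿ(Φ⁻¹ O)`. [folklore] -/
theorem contDiffOn_comp_stAffine {n : WithTop ℕ∞} {U : ℝ × E → F} {O : Set (ℝ × E)}
    (hU : ContDiffOn ℝ n U O) (β γ t₀ : ℝ) (x₀ : E) :
    ContDiffOn ℝ n (fun z => U (stAffine β γ t₀ x₀ z)) (stAffine β γ t₀ x₀ ⁻¹' O) :=
  hU.comp (contDiff_stAffine β γ t₀ x₀).contDiffOn fun _ hz => hz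

omit [FiniteDimensional ℝ E] [NormedSpace ℝ F] in
/-- Continuity transfer: `U ∈ C(A)` implies `U ∘ Φ ∈ C(Φ⁻¹ A)`. [folklore] -/
theorem continuousOn_comp_stAffine {U : ℝ × E → F} {A : Set (ℝ × E)}
    (hU : ContinuousOn U A) (β γ t₀ : ℝ) (x₀ : E) :
    ContinuousOn (fun z => U (stAffine β γ t₀ x₀ z)) (stAffine β γ t₀ x₀ ⁻¹' A) :=
  hU.comp (continuous_stAffine β γ t₀ x₀).continuousOn fun _ hz => hz

/-- **Transfer of the backward heat inequality under parabolic scaling** (Seregin 2014, (A.2.5),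
(A.3.8), (A.3.17)): if `|∂ₜU + ΔU| ≤ c (|U| + |∇U|)` on `O` and `v = U ∘ Φ` with
`Φ(s, y) = (t₀ + λ² s, x₀ + λ y)`, `0 < λ ≤ 1`, then `|∂ₛv + Δv| ≤ c λ (|v| + |∇v|)` on `Φ⁻¹ O`. [cite: Seregin2014, App. A.3 (A.3.8)] -/
theorem backwardHeat_comp_stAffine {U : ℝ × E → F} {O : Set (ℝ × E)} {c l t₀ : ℝ} {x₀ : E}
    (hc : 0 ≤ c) (hl : 0 < l) (hl1 : l ≤ 1)
    (hBH : ∀ w ∈ O, ‖dt U w + lap U w‖ ≤ c * (‖U w‖ + Real.sqrt (gradSq U w))) :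
    ∀ z ∈ stAffine (l ^ 2) l t₀ x₀ ⁻¹' O,
      ‖dt (fun z => U (stAffine (l ^ 2) l t₀ x₀ z)) z +
          lap (fun z => U (stAffine (l ^ 2) l t₀ x₀ z)) z‖ ≤
        (c * l) * (‖U (stAffine (l ^ 2) l t₀ x₀ z)‖ +
          Real.sqrt (gradSq (fun z => U (stAffine (l ^ 2) l t₀ x₀ z)) z)) := by
  intro z hz
  have hl2 : (l ^ 2 : ℝ) ≠ 0 := by positivity
  rw [dt_comp_stAffine hl2 hl.ne', lap_comp_stAffine hl2 hl.ne', gradSq_comp_stAffine hl2 hl.ne',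
    ← smul_add, norm_smul, Real.norm_eq_abs, abs_of_pos (by positivity : (0 : ℝ) < l ^ 2),
    Real.sqrt_mul (sq_nonneg _), Real.sqrt_sq hl.le]
  have h := hBH _ hz
  have hg : 0 ≤ Real.sqrt (gradSq U (stAffine (l ^ 2) l t₀ x₀ z)) := Real.sqrt_nonneg _
  have hn : 0 ≤ ‖U (stAffine (l ^ 2) l t₀ x₀ z)‖ := norm_nonneg _
  calc l ^ 2 * ‖dt U (stAffine (l ^ 2) l t₀ x₀ z) + lap U (stAffine (l ^ 2) l t₀ x₀ z)‖
      ≤ l ^ 2 * (c * (‖U (stAffine (l ^ 2) l t₀ x₀ z)‖ +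
          Real.sqrt (gradSq U (stAffine (l ^ 2) l t₀ x₀ z)))) :=
        mul_le_mul_of_nonneg_left h (by positivity)
    _ = (c * l) * (l * ‖U (stAffine (l ^ 2) l t₀ x₀ z)‖ +
          l * Real.sqrt (gradSq U (stAffine (l ^ 2) l t₀ x₀ z))) := by ring
    _ ≤ (c * l) * (‖U (stAffine (l ^ 2) l t₀ x₀ z)‖ +
          l * Real.sqrt (gradSq U (stAffine (l ^ 2) l t₀ x₀ z))) := by
        gcongr
        exact mul_le_of_le_one_left hn hl1

end ChainRules


/-! ### The initial layer: `∫ ‖V‖² ≤ T² ∫ ‖∂ₛV‖²` -/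

section Layer

variable {E : Type*} [NormedAddCommGroup E] [InnerProductSpace ℝ E] [FiniteDimensional ℝ E]
  [MeasurableSpace E] [BorelSpace E]
variable {F : Type*} [NormedAddCommGroup F] [NormedSpace ℝ F] [CompleteSpace F]

omit [FiniteDimensional ℝ E] [MeasurableSpace E] [BorelSpace E] in
/-- **Pointwise layer estimate.** Let `V` be `C¹` on an open set `O ⊇ ]s₀, s₀ + S[ × B`,
continuous on `[s₀, s₀ + S[ × B` with `V(s₀, ·) = 0` on `B`. Then for `y ∈ B` and
`s₀ < s < s₀ + T ≤ s₀ + S`: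
`‖V(s, y)‖² ≤ T ∫_{]s₀, s₀+T[} ‖∂ₛV(σ, y)‖² dσ` (fundamental theorem of calculus on `[a, s]`,
`a ↓ s₀`, and Cauchy–Schwarz; lower Lebesgue integrals). [folklore] -/
theorem enorm_sq_le_mul_lintegral_dt {V : ℝ × E → F} {O : Set (ℝ × E)} {B : Set E}
    {s₀ S T : ℝ} (hO : IsOpen O) (hV : ContDiffOn ℝ 1 V O) (hsub : Ioo s₀ (s₀ + S) ×ˢ B ⊆ O)
    (hcont : ContinuousOn V (Ico s₀ (s₀ + S) ×ˢ B)) (h0 : ∀ y ∈ B, V (s₀, y) = 0)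
    (hTS : T ≤ S) {y : E} (hy : y ∈ B) {s : ℝ} (hs : s ∈ Ioo s₀ (s₀ + T)) :
    ‖V (s, y)‖ₑ ^ 2 ≤
      ENNReal.ofReal T * ∫⁻ σ in Ioo s₀ (s₀ + T), ‖dt V (σ, y)‖ₑ ^ 2 := by
  have hT : 0 < T := by linarith [hs.1, hs.2]
  -- the slice `g σ = V (σ, y)` and its derivative `g' σ = ∂ₛV (σ, y)` on `]s₀, s₀ + S[`
  set g : ℝ → F := fun σ => V (σ, y) with hg
  set g' : ℝ → F := fun σ => dt V (σ, y) with hg'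
  have hmemO : ∀ σ ∈ Ioo s₀ (s₀ + S), (σ, y) ∈ O := fun σ hσ => hsub ⟨hσ, hy⟩
  have hderiv : ∀ σ ∈ Ioo s₀ (s₀ + S), HasDerivAt g (g' σ) σ := by
    intro σ hσ
    have hd : DifferentiableAt ℝ V (σ, y) :=
      (hV.differentiableOn one_ne_zero).differentiableAt (hO.mem_nhds (hmemO σ hσ))
    have h1 : HasDerivAt (fun σ : ℝ => ((σ, y) : ℝ × E)) ((1, 0) : ℝ × E) σ := by
      have := (hasDerivAt_id σ).prodMk (hasDerivAt_const σ y)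
      simpa using this
    have h2 : HasDerivAt (fun σ : ℝ => V (σ, y)) (fderiv ℝ V (σ, y) ((1, 0) : ℝ × E)) σ :=
      hd.hasFDerivAt.comp_hasDerivAt σ h1
    exact h2
  have hg'c : ContinuousOn g' (Ioo s₀ (s₀ + S)) := by
    have hf : ContinuousOn (fun w => fderiv ℝ V w ((1, 0) : ℝ × E)) O :=
      (hV.continuousOn_fderiv_of_isOpen hO le_rfl).clm_apply continuousOn_const
    have hsl : Continuous fun σ : ℝ => ((σ, y) : ℝ × E) := by fun_prop
    exact (hf.comp hsl.continuousOn fun σ hσ => hmemO σ hσ).congr fun σ _ => by simp [hg', dt]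
  -- `L = ∫ ‖g'‖ₑ` over the layer
  set L : ℝ≥0∞ := ∫⁻ σ in Ioo s₀ (s₀ + T), ‖g' σ‖ₑ with hL
  -- (1) `‖V(s,y) - V(a,y)‖ₑ ≤ L` for `s₀ < a < s`
  have h1 : ∀ a ∈ Ioo s₀ s, ‖g s - g a‖ₑ ≤ L := by
    intro a ha
    have has : a ≤ s := ha.2.le
    have hIcc : Icc a s ⊆ Ioo s₀ (s₀ + S) := fun σ hσ =>
      ⟨lt_of_lt_of_le ha.1 hσ.1, lt_of_le_of_lt hσ.2 (by linarith [hs.2])⟩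
    have hftc : ∫ σ in a..s, g' σ = g s - g a := by
      refine intervalIntegral.integral_eq_sub_of_hasDerivAt (fun σ hσ => hderiv σ (hIcc ?_)) ?_
      · rwa [uIcc_of_le has] at hσ
      · exact ((hg'c.mono hIcc).intervalIntegrable_of_Icc has)
    rw [← hftc, intervalIntegral.integral_of_le has]
    calc ‖∫ σ in Ioc a s, g' σ‖ₑ ≤ ∫⁻ σ in Ioc a s, ‖g' σ‖ₑ := enorm_integral_le_lintegral_enorm _
      _ ≤ L := lintegral_mono_set fun σ hσ => ⟨lt_trans ha.1 hσ.1, lt_of_le_of_lt hσ.2 hs.2⟩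
  -- (2) let `a ↓ s₀`: `‖V(s,y)‖ₑ ≤ L`
  have h2 : ‖g s‖ₑ ≤ L := by
    by_cases hLtop : L = ∞
    · rw [hLtop]; exact le_top
    -- continuity of the slice at `s₀` from the right, with `g s₀ = 0`
    have hlim : Tendsto g (𝓝[>] s₀) (𝓝 0) := by
      have hcw : ContinuousWithinAt V (Ico s₀ (s₀ + S) ×ˢ B) (s₀, y) :=
        hcont _ ⟨⟨le_rfl, by linarith [hs.1, hs.2]⟩, hy⟩
      have hsl : Tendsto (fun σ : ℝ => ((σ, y) : ℝ × E)) (𝓝[>] s₀)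
          (𝓝[Ico s₀ (s₀ + S) ×ˢ B] (s₀, y)) := by
        refine tendsto_nhdsWithin_iff.2 ⟨?_, ?_⟩
        · exact ((continuous_id.prodMk continuous_const).tendsto s₀).mono_left
            nhdsWithin_le_nhds
        · have hev : ∀ᶠ σ in 𝓝[>] s₀, σ < s₀ + S := by
            have : s₀ < s₀ + S := by linarith [hs.1, hs.2]
            exact mem_nhdsWithin_of_mem_nhds (Iio_mem_nhds this)
          filter_upwards [hev, self_mem_nhdsWithin] with σ hσ hσ0
          exact ⟨⟨le_of_lt hσ0, hσ⟩, hy⟩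
      have := hcw.tendsto.comp hsl
      rw [h0 y hy] at this
      exact this
    have hlim' : Tendsto (fun a => ‖g s - g a‖) (𝓝[>] s₀) (𝓝 ‖g s‖) := by
      have := (tendsto_const_nhds (x := g s)).sub hlim
      rw [sub_zero] at this
      exact this.norm
    have hev : ∀ᶠ a in 𝓝[>] s₀, ‖g s - g a‖ ≤ L.toReal := by
      have h2' : ∀ᶠ a in 𝓝[>] s₀, a < s := mem_nhdsWithin_of_mem_nhds (Iio_mem_nhds hs.1)
      filter_upwards [h2', self_mem_nhdsWithin] with a ha ha0
      have := h1 a ⟨ha0, ha⟩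
      rw [← ofReal_norm] at this
      exact (ENNReal.ofReal_le_iff_le_toReal hLtop).1 this
    have hle : ‖g s‖ ≤ L.toReal := le_of_tendsto hlim' hev
    rw [← ofReal_norm]
    exact (ENNReal.ofReal_le_ofReal hle).trans (ENNReal.ofReal_toReal_le)
  -- (3) Cauchy–Schwarz: `L² ≤ T ∫ ‖g'‖ₑ²`
  have hmeas : AEMeasurable (fun σ => ‖g' σ‖ₑ) (volume.restrict (Ioo s₀ (s₀ + T))) :=
    ((hg'c.mono (Ioo_subset_Ioo_right (by linarith))).aestronglyMeasurable
      measurableSet_Ioo).enorm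
  have h3 : L ^ 2 ≤ ENNReal.ofReal T * ∫⁻ σ in Ioo s₀ (s₀ + T), ‖g' σ‖ₑ ^ 2 := by
    have hH := ENNReal.lintegral_mul_le_Lp_mul_Lq (volume.restrict (Ioo s₀ (s₀ + T)))
      Real.HolderConjugate.two_two hmeas aemeasurable_const (g := fun _ => 1)
    simp only [Pi.mul_apply, mul_one, one_mul, ENNReal.one_rpow, lintegral_const,
      Measure.restrict_apply, MeasurableSet.univ, univ_inter, Real.volume_Ioo] at hH
    have hT' : s₀ + T - s₀ = T := by ring
    rw [hT'] at hH
    have hA : (∫⁻ σ in Ioo s₀ (s₀ + T), ‖g' σ‖ₑ ^ (2 : ℝ)) =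
        ∫⁻ σ in Ioo s₀ (s₀ + T), ‖g' σ‖ₑ ^ 2 := by
      refine lintegral_congr fun σ => ?_
      rw [ENNReal.rpow_two]
    rw [hA, ← ENNReal.mul_rpow_of_nonneg _ _ (by norm_num : (0 : ℝ) ≤ 1 / 2)] at hH
    have h' := ENNReal.rpow_le_rpow hH (by norm_num : (0 : ℝ) ≤ 2)
    rw [← ENNReal.rpow_mul, show (1 / 2 : ℝ) * 2 = 1 by norm_num, ENNReal.rpow_one,
      ENNReal.rpow_two, mul_comm] at h'
    exact h'
  calc ‖V (s, y)‖ₑ ^ 2 = ‖g s‖ₑ ^ 2 := rfl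
    _ ≤ L ^ 2 := pow_le_pow_left' h2 2
    _ ≤ _ := h3


/-- **Integrated layer estimate** (`∫ ‖V‖² ≤ T² ∫ ‖∂ₛV‖²` over `]s₀, s₀ + T[ × B`): the pointwise
estimate `enorm_sq_le_mul_lintegral_dt` integrated over the layer (Tonelli). [folklore] -/
theorem setLIntegral_layer_le {V : ℝ × E → F} {O : Set (ℝ × E)} {B : Set E}
    {s₀ S T : ℝ} (hO : IsOpen O) (hV : ContDiffOn ℝ 1 V O) (hsub : Ioo s₀ (s₀ + S) ×ˢ B ⊆ O)
    (hcont : ContinuousOn V (Ico s₀ (s₀ + S) ×ˢ B)) (h0 : ∀ y ∈ B, V (s₀, y) = 0)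
    (hB : MeasurableSet B) (hT : 0 < T) (hTS : T ≤ S) :
    ∫⁻ z in Ioo s₀ (s₀ + T) ×ˢ B, ‖V z‖ₑ ^ 2 ≤
      ENNReal.ofReal (T ^ 2) * ∫⁻ z in Ioo s₀ (s₀ + T) ×ˢ B, ‖dt V z‖ₑ ^ 2 := by
  set A : Set (ℝ × E) := Ioo s₀ (s₀ + T) ×ˢ B with hA
  have hAm : MeasurableSet A := measurableSet_Ioo.prod hB
  have hAsub : A ⊆ O := (Set.prod_mono (Ioo_subset_Ioo_right (by linarith)) Subset.rfl).trans hsub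
  -- measurability of the two integrands on the layer
  have hdtc : ContinuousOn (dt V) O := by
    have hf : ContinuousOn (fun w => fderiv ℝ V w ((1, 0) : ℝ × E)) O :=
      (hV.continuousOn_fderiv_of_isOpen hO le_rfl).clm_apply continuousOn_const
    exact hf.congr fun w _ => by simp [dt]
  have hm2 : AEMeasurable (fun z => ‖dt V z‖ₑ ^ 2) (volume.restrict A) :=
    (((hdtc.mono hAsub).aestronglyMeasurable hAm).enorm.pow_const _)
  -- product structure of the restricted measure
  have hμ : (volume.restrict A : Measure (ℝ × E)) =
      (volume.restrict (Ioo s₀ (s₀ + T))).prod (volume.restrict B) := by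
    rw [hA, Measure.volume_eq_prod, Measure.prod_restrict]
  -- Tonelli for the left-hand side, then the pointwise estimate
  have hptw : ∀ s ∈ Ioo s₀ (s₀ + T), ∀ y ∈ B, ‖V (s, y)‖ₑ ^ 2 ≤
      ENNReal.ofReal T * ∫⁻ σ in Ioo s₀ (s₀ + T), ‖dt V (σ, y)‖ₑ ^ 2 := fun s hs y hy =>
    enorm_sq_le_mul_lintegral_dt hO hV hsub hcont h0 hTS hy hs
  have hm1 : AEMeasurable (fun z => ‖V z‖ₑ ^ 2) (volume.restrict A) :=
    ((((hV.continuousOn.mono hAsub)).aestronglyMeasurable hAm).enorm.pow_const _)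
  calc ∫⁻ z in A, ‖V z‖ₑ ^ 2
      = ∫⁻ s in Ioo s₀ (s₀ + T), ∫⁻ y in B, ‖V (s, y)‖ₑ ^ 2 := by
        rw [hμ, lintegral_prod _ (by rw [← hμ]; exact hm1)]
    _ ≤ ∫⁻ s in Ioo s₀ (s₀ + T), ∫⁻ y in B,
          ENNReal.ofReal T * ∫⁻ σ in Ioo s₀ (s₀ + T), ‖dt V (σ, y)‖ₑ ^ 2 := by
        refine setLIntegral_mono' measurableSet_Ioo fun s hs => ?_
        exact setLIntegral_mono' hB fun y hy => hptw s hs y hy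
    _ = ENNReal.ofReal T * (ENNReal.ofReal T *
          ∫⁻ y in B, ∫⁻ σ in Ioo s₀ (s₀ + T), ‖dt V (σ, y)‖ₑ ^ 2) := by
        rw [lintegral_const_mul' _ _ ENNReal.ofReal_ne_top, lintegral_const,
          Measure.restrict_apply MeasurableSet.univ, univ_inter, Real.volume_Ioo,
          show s₀ + T - s₀ = T by ring, mul_comm]
    _ = ENNReal.ofReal (T ^ 2) * ∫⁻ z in A, ‖dt V z‖ₑ ^ 2 := by
        rw [← mul_assoc, ← ENNReal.ofReal_mul hT.le, ← sq, hμ,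
          lintegral_prod_symm _ (by rw [← hμ]; exact hm2)]

/-- **The initial layer is negligible at the rate `θ²`.** Under the hypotheses of
`setLIntegral_layer_le`, if moreover `B` has finite measure and `∂ₛV` is square integrable on
`]s₀, s₀ + S[ × B`, then for every `ε > 0` there is `θ₀ ∈ ]0, S]` with
`∫_{]s₀, s₀+θ[ × B} ‖V‖² ≤ ε θ²` for all `0 < θ ≤ θ₀` (absolute continuity of the integral).
This controls the cut-off error at the initial slice in Seregin's Lemmas A.2–A.3, where the
source extends `u` by zero to `t < 0` instead. [folklore] -/
theorem exists_layer_integral_le {V : ℝ × E → F} {O : Set (ℝ × E)} {B : Set E}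
    {s₀ S : ℝ} (hO : IsOpen O) (hV : ContDiffOn ℝ 1 V O) (hsub : Ioo s₀ (s₀ + S) ×ˢ B ⊆ O)
    (hcont : ContinuousOn V (Ico s₀ (s₀ + S) ×ˢ B)) (h0 : ∀ y ∈ B, V (s₀, y) = 0)
    (hB : MeasurableSet B) (hBvol : volume B ≠ ∞) (hS : 0 < S)
    (hfin : ∫⁻ z in Ioo s₀ (s₀ + S) ×ˢ B, ‖dt V z‖ₑ ^ 2 < ∞) {ε : ℝ} (hε : 0 < ε) :
    ∃ θ₀ ∈ Ioc 0 S, ∀ θ ∈ Ioc 0 θ₀,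
      ∫ z in Ioo s₀ (s₀ + θ) ×ˢ B, ‖V z‖ ^ 2 ≤ ε * θ ^ 2 := by
  set A : ℝ → Set (ℝ × E) := fun θ => Ioo s₀ (s₀ + θ) ×ˢ B with hA
  set μ : Measure (ℝ × E) := volume.restrict (A S) with hμ
  -- `μ (A θ) → 0` as `θ → 0⁺`
  have hvol : Tendsto (μ ∘ A) (𝓝[>] 0) (𝓝 0) := by
    have h1 : Tendsto (fun θ : ℝ => ENNReal.ofReal θ * volume B) (𝓝[>] 0) (𝓝 0) := by
      have h0' : Tendsto (fun θ : ℝ => ENNReal.ofReal θ) (𝓝[>] (0 : ℝ)) (𝓝 (ENNReal.ofReal 0)) :=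
        ENNReal.tendsto_ofReal (tendsto_nhdsWithin_of_tendsto_nhds (s := Ioi (0 : ℝ))
          (continuous_id.tendsto (0 : ℝ)))
      have h := ENNReal.Tendsto.mul_const h0' (Or.inr hBvol : ENNReal.ofReal 0 ≠ 0 ∨ volume B ≠ ∞)
      simpa using h
    refine tendsto_of_tendsto_of_tendsto_of_le_of_le tendsto_const_nhds h1
      (fun θ => (bot_le : (0 : ℝ≥0∞) ≤ (μ ∘ A) θ)) fun θ => ?_
    calc (μ ∘ A) θ = volume (A θ ∩ A S) := by
          simp only [comp_apply, hμ]
          rw [Measure.restrict_apply (measurableSet_Ioo.prod hB)]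
      _ ≤ volume (A θ) := measure_mono inter_subset_left
      _ = ENNReal.ofReal θ * volume B := by
          simp only [hA]
          rw [Measure.volume_eq_prod, Measure.prod_prod, Real.volume_Ioo]
          congr 2; ring
  have htend : Tendsto (fun θ => ∫⁻ z in A θ, ‖dt V z‖ₑ ^ 2 ∂μ) (𝓝[>] 0) (𝓝 0) :=
    tendsto_setLIntegral_zero (μ := μ) hfin.ne hvol
  -- pick `θ₁ > 0` with small tail integral
  have hε' : (0 : ℝ≥0∞) < ENNReal.ofReal ε := ENNReal.ofReal_pos.2 hε
  obtain ⟨θ₁, hθ₁, hθ₁pos⟩ := (((tendsto_order.1 htend).2 _ hε').and self_mem_nhdsWithin).exists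
  refine ⟨min θ₁ S, ⟨lt_min hθ₁pos hS, min_le_right _ _⟩, fun θ hθ => ?_⟩
  have hθS : θ ≤ S := hθ.2.trans (min_le_right _ _)
  have hθ1 : θ ≤ θ₁ := hθ.2.trans (min_le_left _ _)
  -- the tail integral over `A θ` is at most `ε`
  have htail : ∫⁻ z in A θ, ‖dt V z‖ₑ ^ 2 ≤ ENNReal.ofReal ε := by
    have hsub' : A θ ⊆ A S := Set.prod_mono (Ioo_subset_Ioo_right (by linarith)) Subset.rfl
    have e1 : ∫⁻ z in A θ, ‖dt V z‖ₑ ^ 2 = ∫⁻ z in A θ, ‖dt V z‖ₑ ^ 2 ∂μ := by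
      rw [hμ, Measure.restrict_restrict (measurableSet_Ioo.prod hB),
        inter_eq_self_of_subset_left hsub']
    have e2 : ∫⁻ z in A θ, ‖dt V z‖ₑ ^ 2 ∂μ ≤ ∫⁻ z in A θ₁, ‖dt V z‖ₑ ^ 2 ∂μ :=
      lintegral_mono_set (Set.prod_mono (Ioo_subset_Ioo_right (by linarith)) Subset.rfl)
    rw [e1]
    exact e2.trans hθ₁.le
  -- the layer estimate
  have hlayer := setLIntegral_layer_le hO hV hsub hcont h0 hB hθ.1 hθS
  have hbound : ∫⁻ z in A θ, ‖V z‖ₑ ^ 2 ≤ ENNReal.ofReal (ε * θ ^ 2) := by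
    calc ∫⁻ z in A θ, ‖V z‖ₑ ^ 2 ≤ ENNReal.ofReal (θ ^ 2) * ∫⁻ z in A θ, ‖dt V z‖ₑ ^ 2 := hlayer
      _ ≤ ENNReal.ofReal (θ ^ 2) * ENNReal.ofReal ε := mul_le_mul_right htail _
      _ = ENNReal.ofReal (ε * θ ^ 2) := by
          rw [← ENNReal.ofReal_mul (by positivity), mul_comm]
  -- pass to the Bochner integral
  have hAsub : A θ ⊆ O := (Set.prod_mono (Ioo_subset_Ioo_right (by linarith)) Subset.rfl).trans hsub
  have hAm : MeasurableSet (A θ) := measurableSet_Ioo.prod hB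
  have hsm : AEStronglyMeasurable (fun z => ‖V z‖ ^ 2) (volume.restrict (A θ)) :=
    ((hV.continuousOn.mono hAsub).norm.pow 2).aestronglyMeasurable hAm
  rw [integral_eq_lintegral_of_nonneg_ae (Eventually.of_forall fun z => sq_nonneg _) hsm]
  have e3 : ∫⁻ z in A θ, ENNReal.ofReal (‖V z‖ ^ 2) = ∫⁻ z in A θ, ‖V z‖ₑ ^ 2 := by
    refine lintegral_congr fun z => ?_
    rw [ENNReal.ofReal_pow (norm_nonneg _), ofReal_norm]
  rw [e3]
  exact ENNReal.toReal_le_of_le_ofReal (by positivity) hbound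

end Layer


/-! ### Transport of the integrability hypothesis (A.3.4) under rescaling -/

section Transport

variable {E : Type*} [NormedAddCommGroup E] [InnerProductSpace ℝ E] [FiniteDimensional ℝ E]
  [MeasurableSpace E] [BorelSpace E]
variable {F : Type*} [NormedAddCommGroup F] [NormedSpace ℝ F]
variable {β γ t₀ : ℝ} {x₀ : E}

omit [MeasurableSpace E] [BorelSpace E] in
/-- `Φ` maps bounded sets to bounded sets. [folklore] -/
theorem isBounded_image_stAffine {K : Set (ℝ × E)} (hK : Bornology.IsBounded K) :
    Bornology.IsBounded (stAffine β γ t₀ x₀ '' K) := by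
  obtain ⟨R, hR⟩ := hK.subset_closedBall (0 : ℝ × E)
  have hc : IsCompact (stAffine β γ t₀ x₀ '' closedBall (0 : ℝ × E) R) :=
    (isCompact_closedBall _ _).image (continuous_stAffine β γ t₀ x₀)
  exact hc.isBounded.subset (image_mono hR)

/-- `Φ` maps measurable sets to measurable sets (`β, γ ≠ 0`). [folklore] -/
theorem measurableSet_image_stAffine (hβ : β ≠ 0) (hγ : γ ≠ 0) {K : Set (ℝ × E)}
    (hK : MeasurableSet K) : MeasurableSet (stAffine β γ t₀ x₀ '' K) :=
  (measurableEmbedding_stAffine hβ hγ t₀ x₀).measurableSet_image.2 hK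

/-- **Change of variables for `∫ ‖∂ₛ(U ∘ Φ)‖²`**:
`∫_K ‖∂ₛ(U ∘ Φ)‖² = β² (β γⁿ)⁻¹ ∫_{Φ K} ‖∂ₜU‖²` (lower Lebesgue integrals). [folklore] -/
theorem setLIntegral_enorm_dt_comp_stAffine (hβ : 0 < β) (hγ : 0 < γ) (U : ℝ × E → F)
    {K : Set (ℝ × E)} :
    ∫⁻ z in K, ‖dt (fun z => U (stAffine β γ t₀ x₀ z)) z‖ₑ ^ 2 =
      ENNReal.ofReal (β ^ 2) * (ENNReal.ofReal (β * γ ^ Module.finrank ℝ E)⁻¹ *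
        ∫⁻ w in stAffine β γ t₀ x₀ '' K, ‖dt U w‖ₑ ^ 2) := by
  have hinj : Injective (stAffine β γ t₀ x₀) :=
    (stAffineHomeomorph hβ.ne' hγ.ne' t₀ x₀).injective
  have e1 : ∀ z, ‖dt (fun z => U (stAffine β γ t₀ x₀ z)) z‖ₑ ^ 2 =
      ENNReal.ofReal (β ^ 2) * ‖dt U (stAffine β γ t₀ x₀ z)‖ₑ ^ 2 := by
    intro z
    rw [dt_comp_stAffine hβ.ne' hγ.ne', enorm_smul, mul_pow, Real.enorm_eq_ofReal hβ.le,
      ENNReal.ofReal_pow hβ.le]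
  simp_rw [e1]
  rw [lintegral_const_mul' _ _ ENNReal.ofReal_ne_top]
  congr 1
  rw [← setLIntegral_preimage_comp_stAffine hβ hγ t₀ x₀ (fun w => ‖dt U w‖ₑ ^ 2),
    hinj.preimage_image]

/-- **Transport of (A.3.4) in time.** If `∂ₜU` is square integrable over `Φ(K)` then
`∂ₛ(U ∘ Φ)` is square integrable over `K`. [folklore] -/
theorem setLIntegral_enorm_dt_comp_stAffine_lt_top (hβ : 0 < β) (hγ : 0 < γ) {U : ℝ × E → F}
    {K : Set (ℝ × E)} (hfin : ∫⁻ w in stAffine β γ t₀ x₀ '' K, ‖dt U w‖ₑ ^ 2 < ∞) :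
    ∫⁻ z in K, ‖dt (fun z => U (stAffine β γ t₀ x₀ z)) z‖ₑ ^ 2 < ∞ := by
  rw [setLIntegral_enorm_dt_comp_stAffine hβ hγ]
  exact ENNReal.mul_lt_top ENNReal.ofReal_lt_top (ENNReal.mul_lt_top ENNReal.ofReal_lt_top hfin)

end Transport

end Carleman

end Literature.Analysis.FluidPDE
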